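import Summits.Ventures.Crystal3D.Theorems.StickyWulffConstantCoaxialWallLawOneFccFLayer
import Summits.Ventures.Crystal3D.Theorems.StickyWulffConstantCoaxialWallLawTailResidueClosingT5
import HarnessLib

/-!
# The ONE-FCC F_layer law in the SHARED-HYPOTHESIS form: `stub_fLayerOneFcc` from lane F's registered certificate statements

HONEST FRAMING. Venture `Summits/Ventures/Crystal3D` (cell `crystal3d-full`); helper `--supports` the crux `CoaxialWallLaw`
(stmt-Ventures-19481, `route-Ventures-StickyWulffConstant`, registered line 'Certificates' v4) in its role as owner of lane T's debt
T-F2 / F_layer, OneFcc half: TexShadow v8.8's `stub_fLayerOneFcc : ∃ C, FLayerTwinFamilyOneFccAt (13/25) C 10` (crux `TextureLiminfV5`,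
stmt-Ventures-23912).  cf-p1 DECISION (cxcii): «land the closer in the SHARED-HYPOTHESIS form … lane T then registers THAT statement as a stub
(items dedupe by statement across routes/lines, so one proof closes lane F's and lane T's copy at once)».
Census-free, standard axioms; pure composition of tree theorems — NOTHING new about the crux is proved; F-C1 not moved.

WHICH HYPOTHESES (the answer to (cxcii)).  `fLayerOneFcc_of_twinRow` (…OneFccFLayer, p713134) consumes the TWIN ROW OF RECORD
`EndRowTwinHalfTurnA ver sF` with `sF·√(2/3) ≤ 4`.  That row is NOT a consequence of the on-site flat certificate
`EndRowOnSiteFlatA v2 (9/2) coaxialModuleUniverse` (= Certificates' `stub_flatCx`) alone: the bridge of record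
`endRowTwinHalfTurnA_of_onSiteFlatA_cx` (…OnSiteBridgeCx) needs the OFF-MODULE twin tail `EndRowTwinTailA v2 sF coaxialModuleUniverse` as
well, and lane F discharges its tails only through the JOINT row: `endRowJointA_of_lensCertificates_mono` (…TailResidueClosingM) gives
`EndRowJointA v2 (2√6)` from {flatCx (9/2), jointFlatCx (2√6), LensCert (2√6), MonoCapture, ModuleCapture, MultiGrainSmall (2√6)}, and
`endRowTwinHalfTurnA_of_jointA` (…RowsOfJoint) turns it into the twin row at `sF = 2√6` — which qualifies EXACTLY: `2√6·√(2/3) = 4`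
(`two_sqrt_six_mul_sqrt_two_thirds`).  Hence:

* `fLayerOneFcc_of_jointA` — `KissingGap δ → KissingClassification δ → 0 ≤ sF → sF·√(2/3) ≤ 4 → EndRowJointA ver sF → ∃ C, …OneFccAt (13/25) C 10`;
  `fLayerOneFcc_of_jointA_twoSqrtSix` — the instance `sF = 2√6`;
* `fLayerOneFcc_of_onSiteFlatA_cx` — from the 𝒰_cx flat certificate AND the off-module twin tail (any version / line with `sF·√(2/3) ≤ 4`);
* **`fLayerOneFcc_of_lensCertificates_split`** — THE SHARED-HYPOTHESIS CLOSER: binders = NINE of the eleven registered stub statements of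
  'Certificates' v4 VERBATIM (all but `stub_starFar`, `stub_E1`, which F_layer does not need):
  `KissingGap (5/2) → KissingClassification (5/2) → EndRowOnSiteFlatA v2 (9/2) 𝒰_cx → EndRowOnSiteJointFlatA v2 (2√6) 𝒰_cx → LensCert (2√6) →
   MonoCapture → ModuleCapture → MultiGrainSmallLow (2√6) 3 → (KissingGap (5/2) → KissingClassification (5/2) → MultiGrainSmallHigh (2√6) 3) →
   ∃ C, FLayerTwinFamilyOneFccAt (13/25) C 10`
  — so lane T may derive `stub_fLayerOneFcc := fLayerOneFcc_of_lensCertificates_split stub_gap stub_classification stub_flatCx stub_jointFlatCx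
  stub_lensCert stub_monoCapture stub_moduleCapture stub_multiGrainSmallLow stub_multiGrainSmallHigh` once it carries those statements as stubs;
* `fLayerOneFcc_of_lensCertificates_mono` (v3 binder `MultiGrainSmall (2√6)`), `fLayerOneFcc_of_lensCertificates_high` (low half discharged by
  `TailResidue.multiGrainSmallLow_three`; eight binders).
WHAT THIS IS NOT: no certificate, tail, capture or kissing fact is proved here; not the BothFaulted half of T-F2; F-C1 not moved.
-/

noncomputable section

namespace Summit.Ventures.Crystal3D.Theorems

open Summit.Ventures.Crystal3D TailResidue
open Summit.Ventures.Crystal3D.Cruxes.TextureLiminf.TexShadow (FLayerTwinFamilyOneFccAt)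

/-- `2√6 · √(2/3) = 4`: the joint-row line `2√6` meets the F_layer requirement `sF·√(2/3) ≤ 4` with equality. -/
theorem two_sqrt_six_mul_sqrt_two_thirds : 2 * Real.sqrt 6 * Real.sqrt (2 / 3) = 4 := by
  have h : Real.sqrt 6 * Real.sqrt (2 / 3) = 2 := by
    rw [← Real.sqrt_mul (by norm_num : (0 : ℝ) ≤ 6), show (6 : ℝ) * (2 / 3) = 2 ^ 2 by norm_num,
      Real.sqrt_sq (by norm_num : (0 : ℝ) ≤ 2)]
  rw [mul_assoc, h]
  norm_num

/-- `2√6 · √(2/3) ≤ 4`. -/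
theorem two_sqrt_six_mul_sqrt_two_thirds_le : 2 * Real.sqrt 6 * Real.sqrt (2 / 3) ≤ 4 :=
  two_sqrt_six_mul_sqrt_two_thirds.le

/-- **F_layer (OneFcc) from the JOINT row**: `EndRowJointA ver sF` dominates the twin row (`endRowTwinHalfTurnA_of_jointA`). -/
theorem fLayerOneFcc_of_jointA (ver : WordVersion) {δ : ℝ} (hg : KissingGap δ) (hc : KissingClassification δ)
    {sF : ℝ} (hsF : 0 ≤ sF) (hsFd : sF * Real.sqrt (2 / 3) ≤ 4) (hJ : EndRowJointA ver sF) :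
    ∃ C : ℝ, FLayerTwinFamilyOneFccAt (13 / 25) C 10 :=
  fLayerOneFcc_of_twinRow ver hg hc hsF hsFd (endRowTwinHalfTurnA_of_jointA hJ)

/-- **F_layer (OneFcc) from the joint row at the line of record `2√6`.** -/
theorem fLayerOneFcc_of_jointA_twoSqrtSix (ver : WordVersion) {δ : ℝ} (hg : KissingGap δ) (hc : KissingClassification δ)
    (hJ : EndRowJointA ver (2 * Real.sqrt 6)) : ∃ C : ℝ, FLayerTwinFamilyOneFccAt (13 / 25) C 10 :=
  fLayerOneFcc_of_jointA ver hg hc two_sqrt_six_pos.le two_sqrt_six_mul_sqrt_two_thirds_le hJ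

/-- **F_layer (OneFcc) from the 𝒰_cx flat certificate AND the off-module twin tail** (the on-site flat certificate alone does not
give the twin row: `endRowTwinHalfTurnA_of_onSiteFlatA_cx` needs the tail). -/
theorem fLayerOneFcc_of_onSiteFlatA_cx (ver : WordVersion) {δ : ℝ} (hg : KissingGap δ) (hc : KissingClassification δ)
    {sF : ℝ} (hsF : 0 ≤ sF) (hsFd : sF * Real.sqrt (2 / 3) ≤ 4) (hon : EndRowOnSiteFlatA ver sF coaxialModuleUniverse)
    (htail : EndRowTwinTailA ver sF coaxialModuleUniverse) : ∃ C : ℝ, FLayerTwinFamilyOneFccAt (13 / 25) C 10 :=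
  fLayerOneFcc_of_twinRow ver hg hc hsF hsFd (endRowTwinHalfTurnA_of_onSiteFlatA_cx hon htail)

/-- **F_layer (OneFcc) from lane F's v3 certificate set** (binder `MultiGrainSmall (2√6)`): the joint row by
`endRowJointA_of_lensCertificates_mono`, then `fLayerOneFcc_of_jointA_twoSqrtSix`. -/
theorem fLayerOneFcc_of_lensCertificates_mono (hg : KissingGap (5 / 2)) (hc : KissingClassification (5 / 2))
    (honT : EndRowOnSiteFlatA WordVersion.v2 (9 / 2) coaxialModuleUniverse)
    (honJ : EndRowOnSiteJointFlatA WordVersion.v2 (2 * Real.sqrt 6) coaxialModuleUniverse)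
    (hcert : LensCert (2 * Real.sqrt 6)) (hmono : MonoCapture) (hmod : ModuleCapture) (hmulti : MultiGrainSmall (2 * Real.sqrt 6)) :
    ∃ C : ℝ, FLayerTwinFamilyOneFccAt (13 / 25) C 10 :=
  fLayerOneFcc_of_jointA_twoSqrtSix WordVersion.v2 hg hc (endRowJointA_of_lensCertificates_mono honT honJ hcert hmono hmod hmulti)

/-- **THE SHARED-HYPOTHESIS CLOSER (cf-p1 (cxcii)) — `stub_fLayerOneFcc` from NINE of the eleven registered stub statements of
'Certificates' v4, verbatim** (T5 split by payer degree; the kissing facts are threaded into the high half exactly as in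
`coaxialWallLaw_of_lensCertificates_split`). -/
theorem fLayerOneFcc_of_lensCertificates_split (hg : KissingGap (5 / 2)) (hc : KissingClassification (5 / 2))
    (honT : EndRowOnSiteFlatA WordVersion.v2 (9 / 2) coaxialModuleUniverse)
    (honJ : EndRowOnSiteJointFlatA WordVersion.v2 (2 * Real.sqrt 6) coaxialModuleUniverse)
    (hcert : LensCert (2 * Real.sqrt 6)) (hmono : MonoCapture) (hmod : ModuleCapture)
    (hlow : MultiGrainSmallLow (2 * Real.sqrt 6) 3)
    (hhigh : KissingGap (5 / 2) → KissingClassification (5 / 2) → MultiGrainSmallHigh (2 * Real.sqrt 6) 3) :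
    ∃ C : ℝ, FLayerTwinFamilyOneFccAt (13 / 25) C 10 :=
  fLayerOneFcc_of_lensCertificates_mono hg hc honT honJ hcert hmono hmod (multiGrainSmall_of_low_of_high hlow (hhigh hg hc))

/-- **The shared-hypothesis closer with the low half of T5 discharged** (`TailResidue.multiGrainSmallLow_three`; eight binders). -/
theorem fLayerOneFcc_of_lensCertificates_high (hg : KissingGap (5 / 2)) (hc : KissingClassification (5 / 2))
    (honT : EndRowOnSiteFlatA WordVersion.v2 (9 / 2) coaxialModuleUniverse)
    (honJ : EndRowOnSiteJointFlatA WordVersion.v2 (2 * Real.sqrt 6) coaxialModuleUniverse)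
    (hcert : LensCert (2 * Real.sqrt 6)) (hmono : MonoCapture) (hmod : ModuleCapture)
    (hhigh : KissingGap (5 / 2) → KissingClassification (5 / 2) → MultiGrainSmallHigh (2 * Real.sqrt 6) 3) :
    ∃ C : ℝ, FLayerTwinFamilyOneFccAt (13 / 25) C 10 :=
  fLayerOneFcc_of_lensCertificates_split hg hc honT honJ hcert hmono hmod multiGrainSmallLow_three hhigh

end Summit.Ventures.Crystal3D.Theorems

end
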